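/-
# Lattice sampling of Suzuki's screw function under «the supremum of the real parts is attained»
— part B2 (§§4–6: the graded dictionary, the splitting `RH ⟺ MaxRe ∧ LAT(h)`, `§16 ⊂ §17`, placement of `A`)

(rh-split cell, seat rh-split-screw-bridge g12, 2026-08-27; kernel scratch for card
`cards/SPLIT-screw-bridge.md` §17; carved by rh-split-typer-2 g5, lead RULING #138.)  Nothing in this file is a claim
about the truth of RH.
-/
import Summits.RiemannHypothesis.RiemannHypothesis.Theorems.Splittings.ScrewLatticeSupB1
import HarnessLib

/-!
# Part B2 — the splitting `RH ⟺ MaxRe ∧ LAT(h)` (graded dictionary, `§16 ⊂ §17`, placement of the `A`-conjunct)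

CARVE NOTE (rh-split-typer-2 g5, lead RULING #138 (c), 2026-08-27): PART B2 = source lines 257–461 (§§4–6) of the frozen object
`HOME/rh-split-screw-bridge/g12/ScrewLatticeSupB.lean` (sha16 9b7abcaf67226fb2, 462 l; author rh-split-screw-bridge g12),
reproduced BYTE-IDENTICALLY after this header; PART B1 (`Splittings/ScrewLatticeSupB1.lean`, §3 incl. the main theorem
`strip_of_supAttained_of_latticeFloor`; its module docstring is the source's full account of the mechanism) is imported and the
namespace `…Theorems.Splittings.ScrewLatticeSup` re-opened, so all fully-qualified names are the refereed ones.  Contents: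
§4 `supAttainedOrLe_of_quasiRH`, `quasiRH_iff_supAttainedOrLe_and_latticeFloor`, `supAttainedOrLe_of_cofiniteStrip`,
`rh_of_maxRe_of_latticeFloor`, `exists_zero_on_critical_line` (Hardy), `maxRe_of_rh`, the SPLITTING rows
`maxRe_and_latticePos_iff_rh` / `maxRe_and_latticeFloor_iff_rh` / `rh_iff_maxRe_and_latticePos` (every `h > 0`:
RH ⟺ «sup Re ρ attained» ∧ «Ψ(kh) ≥ 0 ∀ k»); §5 `maxRe_of_foz`, `rh_of_foz_of_latticePos'` (`§16 ⊂ §17`); §6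
`exists_quasiRH_of_maxRe`, `exists_quasiRH_half_add_of_maxRe` (an attained supremum gives a zero-free strip).
LABELS (author's, referee rh-split-ref-2 g3 to confirm): `A = MaxRe` RH-implied (Hardy) and not known to imply RH; `B = LAT(h)`
RH-implied (Suzuki Thm 1.7) open tail, not known RH-equivalent; `A ∧ B ⟹ RH` proved here; the conjunction is RH-EQUIVALENT —
CONDITIONAL BOOKKEEPING: «SPLITTING SEARCH over kernel-typed RH-EQUIVALENCES; a splitting A ∧ B ⟹ RH is CONDITIONAL bookkeeping
unless A and B are both proved; nothing here bears on the truth of RH.»  No statement, proof or docstring byte changed by the carve.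
-/

set_option linter.dupNamespace false

noncomputable section

open Complex Filter Topology Finset
open scoped ComplexConjugate

namespace Summit.RiemannHypothesis.RiemannHypothesis.Theorems.Splittings.ScrewLatticeSup

open Literature.NumberTheory.LFunctions
open ZetaZeros.riemannZetaNontrivialZeros
open Summit.RiemannHypothesis.RiemannHypothesis.Theorems.Splittings.ScrewLatticeFoz

/-! ## 4. The graded dictionary and the splitting -/

/-- `QuasiRiemannHypothesis (1/2 + η)` bounds every offset by `η` (so the «attained-or-`≤ η`»
hypothesis holds with `B = η`). -/
theorem supAttainedOrLe_of_quasiRH {η : ℝ} (hq : QuasiRiemannHypothesis (1 / 2 + η)) :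
    ∃ B : ℝ, (∀ ρ : ℂ, ρ ∈ ZetaZeros.riemannZetaNontrivialZeros → |ρ.re - 1 / 2| ≤ B) ∧
      (B ≤ η ∨ ∃ ρ₀ : ℂ, ρ₀ ∈ ZetaZeros.riemannZetaNontrivialZeros ∧ |ρ₀.re - 1 / 2| = B) :=
  ⟨η, ScrewGradedFloor.strip_of_quasiRH hq, Or.inl le_rfl⟩

/-- **THE GRADED DICTIONARY, attained form** (`h > 0`, `η ≥ 0`):
`QuasiRiemannHypothesis (1/2 + η)` **iff** (the offsets `|Re ρ - 1/2|` are bounded by some `B` which is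
`≤ η` or attained) **and** (`Ψ(k h) ≥ -K e^{η k h}` for all `k ∈ ℕ`). -/
theorem quasiRH_iff_supAttainedOrLe_and_latticeFloor {h η : ℝ} (hh : 0 < h) (hη : 0 ≤ η) :
    QuasiRiemannHypothesis (1 / 2 + η) ↔
      ((∃ B : ℝ, (∀ ρ : ℂ, ρ ∈ ZetaZeros.riemannZetaNontrivialZeros → |ρ.re - 1 / 2| ≤ B) ∧
          (B ≤ η ∨ ∃ ρ₀ : ℂ, ρ₀ ∈ ZetaZeros.riemannZetaNontrivialZeros ∧ |ρ₀.re - 1 / 2| = B)) ∧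
        ∃ K : ℝ, ∀ k : ℕ, -K * Real.exp (η * (k * h)) ≤ zetaScrew (k * h)) := by
  constructor
  · exact fun hq ↦ ⟨supAttainedOrLe_of_quasiRH hq, latticeFloor_of_quasiRH hh.le hη hq⟩
  · rintro ⟨⟨B, hB, hatt⟩, hfloor⟩
    have hstrip := strip_of_supAttained_of_latticeFloor hh hη hB hatt hfloor
    exact (ScrewGradedFloor.quasiRH_iff_exp_floor hη).2
      ((ScrewGradedFloor.strip_iff_exp_floor hη).1 hstrip)

/-- A cofinite strip hypothesis (only finitely many zeros beyond `B'`) gives the attained-or-`≤ B'`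
form: either every offset is `≤ B'`, or the finitely many larger offsets have a maximum.  In
particular g11's `strip_of_cofiniteStrip_of_latticeFloor` is a corollary of
`strip_of_supAttained_of_latticeFloor`. -/
theorem supAttainedOrLe_of_cofiniteStrip {B' : ℝ}
    (hfin : {ρ : ℂ | ρ ∈ ZetaZeros.riemannZetaNontrivialZeros ∧ B' < |ρ.re - 1 / 2|}.Finite) :
    ∃ B : ℝ, (∀ ρ : ℂ, ρ ∈ ZetaZeros.riemannZetaNontrivialZeros → |ρ.re - 1 / 2| ≤ B) ∧
      (B ≤ B' ∨ ∃ ρ₀ : ℂ, ρ₀ ∈ ZetaZeros.riemannZetaNontrivialZeros ∧ |ρ₀.re - 1 / 2| = B) := by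
  classical
  set F : Finset ℂ := hfin.toFinset with hF
  have hmemF : ∀ ρ : ℂ, ρ ∈ F ↔ ρ ∈ ZetaZeros.riemannZetaNontrivialZeros ∧ B' < |ρ.re - 1 / 2| :=
    fun ρ ↦ by rw [hF, Set.Finite.mem_toFinset]; rfl
  rcases F.eq_empty_or_nonempty with hFe | hFne
  · refine ⟨B', fun ρ hρ ↦ ?_, Or.inl le_rfl⟩
    by_contra hlt
    have : ρ ∈ F := (hmemF ρ).2 ⟨hρ, not_le.1 hlt⟩
    rw [hFe] at this
    exact Finset.notMem_empty _ this
  · set B : ℝ := F.sup' hFne (fun ρ ↦ |ρ.re - 1 / 2|) with hBdef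
    obtain ⟨ρ₀, hρ₀F, hρ₀B⟩ := Finset.exists_mem_eq_sup' hFne (fun ρ : ℂ ↦ |ρ.re - 1 / 2|)
    have hB'B : B' < B := by
      rw [hBdef, hρ₀B]
      exact ((hmemF ρ₀).1 hρ₀F).2
    refine ⟨B, fun ρ hρ ↦ ?_, Or.inr ⟨ρ₀, ((hmemF ρ₀).1 hρ₀F).1, hρ₀B.symm⟩⟩
    by_cases hρF : ρ ∈ F
    · exact Finset.le_sup' (fun ρ : ℂ ↦ |ρ.re - 1 / 2|) hρF
    · have : ¬ B' < |ρ.re - 1 / 2| := fun h' ↦ hρF ((hmemF ρ).2 ⟨hρ, h'⟩)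
      exact (not_lt.1 this).trans hB'B.le

/-- **MaxRe ∧ (lattice floor) ⇒ RH.**  For every step `h > 0`: if the supremum of the real parts
of the non-trivial zeros is attained (`∃ ρ₀, ∀ ρ, Re ρ ≤ Re ρ₀`) and `Ψ(k h) ≥ -K` for all `k ∈ ℕ`,
then the Riemann hypothesis holds. -/
theorem rh_of_maxRe_of_latticeFloor {h : ℝ} (hh : 0 < h)
    (hmax : ∃ ρ₀ : ℂ, ρ₀ ∈ ZetaZeros.riemannZetaNontrivialZeros ∧
      ∀ ρ : ℂ, ρ ∈ ZetaZeros.riemannZetaNontrivialZeros → ρ.re ≤ ρ₀.re)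
    (hfloor : ∃ K : ℝ, ∀ k : ℕ, -K ≤ zetaScrew (k * h)) : RiemannHypothesis := by
  obtain ⟨ρ₀, hρ₀, hmax⟩ := hmax
  -- the maximal real part is `≥ 1/2` (functional-equation symmetry `ρ ↦ 1 - ρ̄`)
  have hge : 1 / 2 ≤ ρ₀.re := by
    have h1 := hmax _ (one_sub_conj_mem hρ₀)
    simp only [Complex.sub_re, Complex.one_re, Complex.conj_re] at h1
    linarith
  -- offsets are bounded by the attained offset `B = Re ρ₀ - 1/2`
  have hB : ∀ ρ : ℂ, ρ ∈ ZetaZeros.riemannZetaNontrivialZeros →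
      |ρ.re - 1 / 2| ≤ |ρ₀.re - 1 / 2| := by
    intro ρ hρ
    rw [abs_of_nonneg (by linarith : 0 ≤ ρ₀.re - 1 / 2), abs_le]
    have h1 := hmax ρ hρ
    have h2 := hmax _ (one_sub_conj_mem hρ)
    simp only [Complex.sub_re, Complex.one_re, Complex.conj_re] at h2
    constructor <;> linarith
  have hfloor' : ∃ K : ℝ, ∀ k : ℕ, -K * Real.exp (0 * (k * h)) ≤ zetaScrew (k * h) := by
    obtain ⟨K, hK⟩ := hfloor
    exact ⟨K, fun k ↦ by simpa using hK k⟩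
  have hstrip := strip_of_supAttained_of_latticeFloor hh le_rfl hB (Or.inr ⟨ρ₀, hρ₀, rfl⟩) hfloor'
  have hq : QuasiRiemannHypothesis (1 / 2 + 0) :=
    (ScrewGradedFloor.quasiRH_iff_exp_floor le_rfl).2
      ((ScrewGradedFloor.strip_iff_exp_floor le_rfl).1 hstrip)
  rw [add_zero] at hq
  exact quasiRiemannHypothesis_one_half_iff_holds.1 hq

/-- Hardy (1914, tree `Hardy.riemannZeta_zeros_on_critical_line_infinite`): there is a non-trivial
zero on the critical line. -/
theorem exists_zero_on_critical_line :
    ∃ ρ : ℂ, ρ ∈ ZetaZeros.riemannZetaNontrivialZeros ∧ ρ.re = 1 / 2 := by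
  obtain ⟨t, ht⟩ := Hardy.riemannZeta_zeros_on_critical_line_infinite.nonempty
  refine ⟨1 / 2 + t * I, mem_iff'.2 ⟨ht, by simp, by simp; norm_num⟩, by simp⟩

/-- Under RH the supremum of the real parts is attained (at any zero; one exists by Hardy). -/
theorem maxRe_of_rh (hRH : RiemannHypothesis) :
    ∃ ρ₀ : ℂ, ρ₀ ∈ ZetaZeros.riemannZetaNontrivialZeros ∧
      ∀ ρ : ℂ, ρ ∈ ZetaZeros.riemannZetaNontrivialZeros → ρ.re ≤ ρ₀.re := by
  obtain ⟨ρ₀, hρ₀, hρ₀re⟩ := exists_zero_on_critical_line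
  have hq : QuasiRiemannHypothesis (1 / 2 + 0) := by
    rw [add_zero]
    exact quasiRiemannHypothesis_one_half_iff_holds.2 hRH
  have hstrip := ScrewGradedFloor.strip_of_quasiRH hq
  refine ⟨ρ₀, hρ₀, fun ρ hρ ↦ ?_⟩
  have h := hstrip ρ hρ
  have h' : |ρ.re - 1 / 2| = 0 := le_antisymm h (abs_nonneg _)
  rw [abs_eq_zero, sub_eq_zero] at h'
  rw [h', hρ₀re]

/-- **THE SPLITTING** (`h > 0` arbitrary):
`(∃ ρ₀ ∈ 𝒩, ∀ ρ ∈ 𝒩, Re ρ ≤ Re ρ₀) ∧ (∀ k ∈ ℕ, 0 ≤ Ψ(k h)) ↔ RiemannHypothesis`.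
`A = «Θ = sup Re ρ is a maximum»` (Ingham's hypothesis) is RH-implied (Hardy) and not known to imply
RH; `B =` lattice positivity of the screw function is RH-implied (Suzuki Thm 1.7) and not known to
imply RH; `A ∧ B ⇒ RH` is `rh_of_maxRe_of_latticeFloor`. -/
theorem maxRe_and_latticePos_iff_rh {h : ℝ} (hh : 0 < h) :
    ((∃ ρ₀ : ℂ, ρ₀ ∈ ZetaZeros.riemannZetaNontrivialZeros ∧
        ∀ ρ : ℂ, ρ ∈ ZetaZeros.riemannZetaNontrivialZeros → ρ.re ≤ ρ₀.re) ∧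
      ∀ k : ℕ, 0 ≤ zetaScrew (k * h)) ↔ RiemannHypothesis := by
  constructor
  · rintro ⟨hmax, hpos⟩
    exact rh_of_maxRe_of_latticeFloor hh hmax ⟨0, fun k ↦ by simpa using hpos k⟩
  · exact fun hRH ↦ ⟨maxRe_of_rh hRH, latticePos_of_rh hRH h⟩

/-- The same with a bounded-below lattice **tail** (`Ψ(k h) ≥ -K` for `k ≥ k₀`). -/
theorem maxRe_and_latticeFloor_iff_rh {h : ℝ} (hh : 0 < h) (k₀ : ℕ) :
    ((∃ ρ₀ : ℂ, ρ₀ ∈ ZetaZeros.riemannZetaNontrivialZeros ∧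
        ∀ ρ : ℂ, ρ ∈ ZetaZeros.riemannZetaNontrivialZeros → ρ.re ≤ ρ₀.re) ∧
      ∃ K : ℝ, ∀ k : ℕ, k₀ ≤ k → -K ≤ zetaScrew (k * h)) ↔ RiemannHypothesis := by
  constructor
  · rintro ⟨hmax, K, hK⟩
    have hK' : ∀ k : ℕ, k₀ ≤ k → -K * Real.exp (0 * (k * h)) ≤ zetaScrew (k * h) :=
      fun k hk ↦ by simpa using hK k hk
    obtain ⟨K', hK''⟩ := latticeFloor_of_eventually hh.le le_rfl hK'
    exact rh_of_maxRe_of_latticeFloor hh hmax ⟨K', fun k ↦ by simpa using hK'' k⟩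
  · intro hRH
    exact ⟨maxRe_of_rh hRH, 0, fun k _ ↦ by simpa using latticePos_of_rh hRH h k⟩

/-- **E1 normal form**: for every `h > 0`,
`RiemannHypothesis ↔ («sup Re ρ attained») ∧ (∀ k, 0 ≤ Ψ(k h))`. -/
theorem rh_iff_maxRe_and_latticePos {h : ℝ} (hh : 0 < h) :
    RiemannHypothesis ↔
      ((∃ ρ₀ : ℂ, ρ₀ ∈ ZetaZeros.riemannZetaNontrivialZeros ∧
          ∀ ρ : ℂ, ρ ∈ ZetaZeros.riemannZetaNontrivialZeros → ρ.re ≤ ρ₀.re) ∧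
        ∀ k : ℕ, 0 ≤ zetaScrew (k * h)) :=
  (maxRe_and_latticePos_iff_rh hh).symm

/-! ## 5. `§16 ⊂ §17`: finitely many zeros off the line give an attained supremum -/

/-- `CofiniteCriticalLine` (finitely many zeros off the line) implies that `sup Re ρ` is attained:
either all zeros are on the line (then any zero, e.g. Hardy's, is a maximiser) or the finitely many
off-line real parts have a maximum `> 1/2`. -/
theorem maxRe_of_foz (hfoz : Theses.RuelleBand.CofiniteCriticalLine) :
    ∃ ρ₀ : ℂ, ρ₀ ∈ ZetaZeros.riemannZetaNontrivialZeros ∧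
      ∀ ρ : ℂ, ρ ∈ ZetaZeros.riemannZetaNontrivialZeros → ρ.re ≤ ρ₀.re := by
  obtain ⟨B, hB, hatt⟩ := supAttainedOrLe_of_cofiniteStrip (cofiniteStrip_of_foz hfoz le_rfl)
  rcases hatt with hB0 | ⟨ρ₀, hρ₀, hρ₀B⟩
  · -- every zero is on the line
    obtain ⟨ρ₁, hρ₁, hρ₁re⟩ := exists_zero_on_critical_line
    refine ⟨ρ₁, hρ₁, fun ρ hρ ↦ ?_⟩
    have h' : |ρ.re - 1 / 2| = 0 := le_antisymm ((hB ρ hρ).trans hB0) (abs_nonneg _)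
    rw [abs_eq_zero, sub_eq_zero] at h'
    rw [h', hρ₁re]
  · -- the maximal offset `B` is attained at `ρ₀`; replace `ρ₀` by `1 - ρ̄₀` if it lies to the left
    rcases le_or_gt (1 / 2) ρ₀.re with hr | hl
    · refine ⟨ρ₀, hρ₀, fun ρ hρ ↦ ?_⟩
      have h1 := (le_abs_self _).trans ((hB ρ hρ).trans (le_of_eq hρ₀B.symm))
      rw [abs_of_nonneg (by linarith : 0 ≤ ρ₀.re - 1 / 2)] at h1
      linarith
    · refine ⟨1 - conj ρ₀, one_sub_conj_mem hρ₀, fun ρ hρ ↦ ?_⟩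
      simp only [Complex.sub_re, Complex.one_re, Complex.conj_re]
      have h1 := (le_abs_self _).trans ((hB ρ hρ).trans (le_of_eq hρ₀B.symm))
      rw [abs_of_neg (by linarith : ρ₀.re - 1 / 2 < 0)] at h1
      linarith

/-- g11's splitting recovered: `CofiniteCriticalLine ∧ (∀ k, 0 ≤ Ψ(k h)) → RiemannHypothesis`
through `maxRe_of_foz` and `rh_of_maxRe_of_latticeFloor`. -/
theorem rh_of_foz_of_latticePos' {h : ℝ} (hh : 0 < h)
    (hfoz : Theses.RuelleBand.CofiniteCriticalLine) (hpos : ∀ k : ℕ, 0 ≤ zetaScrew (k * h)) :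
    RiemannHypothesis :=
  rh_of_maxRe_of_latticeFloor hh (maxRe_of_foz hfoz) ⟨0, fun k ↦ by simpa using hpos k⟩

/-! ## 6. Placement of the `A`-conjunct: an attained supremum gives a zero-free strip -/

/-- If `sup Re ρ` is attained at a non-trivial zero `ρ₀`, then `ζ` has no zeros in the vertical strip
`Re ρ₀ < Re s < 1`: `QuasiRiemannHypothesis σ₀` holds with `σ₀ = Re ρ₀ < 1`.  So the conjunct
`MaxRe` is at least as strong as an (unconditional) zero-free STRIP, which no known zero-free region
supplies (placement remark of rh-splitx-theory-1 g8); it is RH-free bookkeeping, not evidence. -/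
theorem exists_quasiRH_of_maxRe
    (hmax : ∃ ρ₀ : ℂ, ρ₀ ∈ ZetaZeros.riemannZetaNontrivialZeros ∧
      ∀ ρ : ℂ, ρ ∈ ZetaZeros.riemannZetaNontrivialZeros → ρ.re ≤ ρ₀.re) :
    ∃ σ₀ : ℝ, σ₀ < 1 ∧ QuasiRiemannHypothesis σ₀ := by
  obtain ⟨ρ₀, hρ₀, hmax⟩ := hmax
  refine ⟨ρ₀.re, re_lt_one hρ₀, fun s hs h0 _ ↦ ?_⟩
  have hsNZ : s ∈ ZetaZeros.riemannZetaNontrivialZeros :=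
    mem_of_re_pos hs ((re_pos hρ₀).trans h0)
  exact absurd (hmax s hsNZ) (not_le.2 h0)

/-- The same in the `|Re ρ - 1/2|`-offset normalisation used by the graded dictionary: an attained
supremum of the real parts puts every zero in the closed strip `|Re ρ - 1/2| ≤ |Re ρ₀ - 1/2|` with
`|Re ρ₀ - 1/2| < 1/2`, i.e. `QuasiRiemannHypothesis (1/2 + η₀)` for some `η₀ < 1/2`. -/
theorem exists_quasiRH_half_add_of_maxRe
    (hmax : ∃ ρ₀ : ℂ, ρ₀ ∈ ZetaZeros.riemannZetaNontrivialZeros ∧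
      ∀ ρ : ℂ, ρ ∈ ZetaZeros.riemannZetaNontrivialZeros → ρ.re ≤ ρ₀.re) :
    ∃ η₀ : ℝ, η₀ < 1 / 2 ∧ QuasiRiemannHypothesis (1 / 2 + η₀) := by
  obtain ⟨σ₀, hσ₀, hq⟩ := exists_quasiRH_of_maxRe hmax
  exact ⟨σ₀ - 1 / 2, by linarith, by rwa [show (1 / 2 : ℝ) + (σ₀ - 1 / 2) = σ₀ by ring]⟩

end Summit.RiemannHypothesis.RiemannHypothesis.Theorems.Splittings.ScrewLatticeSup
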